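import Summits.BirchSwinnertonDyer.BirchSwinnertonDyer.Theorems.PrintCf2RamifiedOffTYZSelmerRankOneSixGenus
import Literature.NumberTheory.EllipticCurves.Wuthrich2014.ShaBoundProofs
import Literature.NumberTheory.EllipticCurves.CongruentNumberMonskySelmerParitySelmer
import HarnessLib

/-!
# Crux `PrintCf2.RamifiedOffTYZOfFacts` (stmt-BirchSwinnertonDyer-20509), line `offtyz-v7`, LEAD cycle 10 (cruxlead-20509 g9):
# THE `s = 1`, `n ≡ 6 (mod 8)` STRATUM IN DISPLAY SHAPE (per-`n`, prime enumeration removed, the arithmetic hypothesis in terms of `n` only)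
# and its isogeny saturation (conjuncts 1–3 of 𝔅_ram) — programme F3, part V

THEOREMS ONLY (no `def`, no named fact, no `sorry`), `--supports stmt-BirchSwinnertonDyer-20509`; even companion of g7's `…SelmerRankOneOfDisplays`
(p693978).  §1 turns `rankOne_sha_bsdp_two_of_card_selmer_eight_six_genus` (previous file) into a statement about a square-free `n ≡ 6 (mod 8)` with
`#Sel₂(E_n) = 8`, data `D : GenusPointData n` with `D.Printed`, the CM-point / ring-class / Frobenius package on BOTH kinds of blocks (the body of the
display `CMPointRingClassFrobeniusFourPrinted D` proposed as `Literature/…/TianYuanZhang2017/CMPointFrobeniusFourDisplays.lean`, spelled out here so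
that this file does not wait for it), TYZ Thm 1.1, and the ONE arithmetic hypothesis, now intrinsic in `n`:
  «for every divisor `d ≡ 6 (mod 8)` of `n` with `d = n` or (`n/d ≡ 1 (mod 8)` and `#Sel₂(E_{n/d}) = 4`): `g(d) = #2Cl(ℚ(√−d))` is odd»
(`#Sel₂(E_{n/d}) = 4 ⟺ det M_{n/d} = 1 ⟺ coblockWeight = 1`, Monsky's exact formula, tree theorem).  §2: `BSD(W, 2)` for every globally minimal `W`
isogenous to such an `E_n`, granted GZK, `hasEntireLFunction_rat` and Cassels' invariance.  BSD is not proved by any of this; no class is closed by this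
file (conditional results toward item 23432 `RamifiedOffJumpOneOfFacts`).

References: [cite: TianYuanZhang2017, Thm. 1.1, §3.1, Prop. 3.2 (2), Thm. 3.5, Thm. 3.6 (2), Lemma 3.18, proof of Lemma 3.21]; [cite: Smith2016CongruentDensity,
§2 Table 1, Thm. 1.2]; [cite: LiMa2008, Thm. 0.4]; [cite: HeathBrown1994SelmerCongruentII, Appendix (Monsky), typescript p. 39 L10 – p. 41 L36];
[cite: MilneADT2006, Thm. I.7.3]; [cite: Miller2011LMS, Def. 1.1]; crux notes `Lines/offtyz_v7_SixSector.md`.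
-/

noncomputable section

open scoped Classical NumberField

open WeierstrassCurve WeierstrassCurve.Affine Finset Matrix Literature.NumberTheory.EllipticCurves
  Literature.NumberTheory.EllipticCurves.TianYuanZhang2017
  Literature.NumberTheory.EllipticCurves.TianYuanZhang2017.W2
  Literature.NumberTheory.EllipticCurves.HeathBrown1994
  Literature.NumberTheory.EllipticCurves.HeathBrown1994.Families
  Literature.NumberTheory.EllipticCurves.Smith2016
  Literature.NumberTheory.EllipticCurves.MonskySelmerParity
  Literature.NumberTheory.EllipticCurves.Rank1Residual
  Literature.NumberTheory.QuadraticFields.RingClass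
  Literature.NumberTheory.QuadraticFields
  Summit.BirchSwinnertonDyer.Rank1Residual.P2.GenusPeriodTransferLayer
  Summit.BirchSwinnertonDyer.PrintCf2.QForm

set_option autoImplicit false

namespace Summit.BirchSwinnertonDyer.PrintCf2.MoverAssembly

/-! ## §1 From the per-`n` displays -/

/-- **THE `s = 1` STRATUM FOR A SQUARE-FREE `n ≡ 6 (mod 8)`, display shape.**  For square-free `n ≡ 6 (mod 8)` with `#Sel⁽²⁾(E_n/ℚ) = 8`, data
`D : GenusPointData n` with `D.Printed`, the CM-point / ring-class / Frobenius package on both kinds of blocks (conductor `2` for `d ≡ 5`, conductor `4`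
for `d ≡ 6 (mod 8)`), TYZ Thm 1.1, and «`g(d)` odd for every divisor `d ≡ 6 (mod 8)` of `n` with `d = n` or (`n/d ≡ 1 (mod 8)` and `#Sel₂(E_{n/d}) = 4`)»:
`ord_{s=1} L(E_n,s) = 1`, `rank E_n(ℚ) = 1`, `Ш(E_n)[2^∞] = 0`, `BSD(E_n, 2)`.
[cite: TianYuanZhang2017, Thm. 1.1 and §3 (Prop. 3.2 (2), Thm. 3.5, Thm. 3.6 (2), Lemma 3.18, proof of Lemma 3.21)]
[cite: HeathBrown1994SelmerCongruentII, Appendix (Monsky), typescript p. 41 L20–L36] [cite: Smith2016CongruentDensity, §2 Table 1, Thm. 1.2]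
[cite: Cox2013, §5.C Lemma 5.19, (5.22), §9.A] [cite: Miller2011LMS, Def. 1.1] -/
theorem rankOne_sha_bsdp_two_of_selmerEight_six_of_displays {n : ℕ} (hsq : Squarefree n) (h6 : n % 8 = 6)
    (D : GenusPointData n) (hPr : D.Printed)
    (hCM : ∃ (z : ℕ → APoint D.H) (Φ : ℕ → Finset (D.H ≃ₐ[ℚ] D.H)) (ΓH ΓH' : ℕ → Subgroup (D.H ≃ₐ[ℚ] D.H))
      (σ θ : ℕ → (D.H ≃ₐ[ℚ] D.H)) (c : D.H ≃ₐ[ℚ] D.H)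
      (ρ₂ : (d : ℕ) → (D.galK d →* RingClassGroup (GenusField d) 2))
      (ρ₄ : (d : ℕ) → (D.galK d →* RingClassGroup (GenusField d) 4)),
      D.ConjSpec c ∧
      ∀ d ∈ n.divisors,
        ((d % 8 = 5 ∨ d % 8 = 6) → D.CMBlockSpec d (z d) (Φ d) (ΓH d) (ΓH' d) (σ d) c) ∧
        (d % 8 = 6 → D.ThetaBlockSpec d (z d) (ΓH d) (ΓH' d) (σ d) (θ d)) ∧
        (d % 8 = 7 → D.SevenBlockSpec d) ∧
        (d % 8 = 5 → D.RingClassTwoBlockSpec d (ΓH d) (ΓH' d) (ρ₂ d)) ∧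
        (d % 8 = 6 → D.RingClassFourBlockSpec d (ΓH d) (ΓH' d) (ρ₄ d)) ∧
        (d % 8 = 5 → ∀ q : ℕ, q.Prime → q ∣ d → ∃ φ : D.H ≃ₐ[ℚ] D.H,
          φ (D.sqrtNeg d) = D.sqrtNeg d ∧ φ * φ ∈ ΓH' d ∧ φ D.im = (jacobiSym (-1) q) • D.im ∧
            ∀ r : ℕ, r.Prime → r ∣ n → r ≠ q → φ (D.sqrtNeg r) = (jacobiSym (-(r : ℤ)) q) • D.sqrtNeg r) ∧
        (d % 8 = 6 → ∀ q : ℕ, q.Prime → q ∣ d → q ≠ 2 → ∃ φ : D.H ≃ₐ[ℚ] D.H,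
          φ (D.sqrtNeg d) = D.sqrtNeg d ∧ φ * φ ∈ ΓH' d ∧ φ D.im = (jacobiSym (-1) q) • D.im ∧
            ∀ r : ℕ, r.Prime → r ∣ n → r ≠ q → φ (D.sqrtNeg r) = (jacobiSym (-(r : ℤ)) q) • D.sqrtNeg r))
    (h11 : thm11_parity_of_scriptL)
    (hgen : ∀ d ∈ n.divisors, d % 8 = 6 → (d = n ∨ ((n / d) % 8 = 1 ∧ Nat.card ((congruentNumberCurve (n / d)).selmerGroup 2) = 4)) →
      Odd (genusClassNumber (GenusField d)))
    (hsel : haveI := isElliptic_congruentNumberCurve hsq.ne_zero; Nat.card ((congruentNumberCurve n).selmerGroup 2) = 8) :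
    haveI := isElliptic_congruentNumberCurve hsq.ne_zero
    (congruentNumberCurve n).analyticRank = 1 ∧ (congruentNumberCurve n).mordellWeilRank = 1 ∧
      AddCommGroup.primaryComponent (congruentNumberCurve n).sha 2 = ⊥ ∧ BSDp (congruentNumberCurve n) 2 := by
  have heven : Even n := Nat.even_iff.mpr (by omega)
  obtain ⟨k, p, hp, hp2, hinj, hprod⟩ := exists_odd_prime_family_of_squarefree_even hsq heven
  have hpodd : ∀ i, Odd (p i) := fun i => (hp i).odd_of_ne_two (hp2 i)
  have hmodd : Odd (∏ i, p i) := odd_prod p hp hp2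
  have h3 : (∏ i, p i) % 4 = 3 := by rcases hmodd with ⟨r, hr⟩; omega
  obtain ⟨z, Φ, ΓH, ΓH', σ, θ, c, ρ₂, ρ₄, hc, hall⟩ := hCM
  obtain ⟨hLs, -, hrec, -, h35, -, -, -, h318, -, -⟩ := hPr
  -- the arithmetic hypothesis in block form
  have hgenus : ∀ S : Finset (Fin k), (∑ j ∈ S, addLegendreSym (-1) (p j)) = 1 → coblockWeight p S = 1 →
      Odd (gK (2 * ∏ j ∈ S, p j)) := by
    intro S hS hcw
    have hdS := twice_blockProd_mem_divisors p hp hprod.symm S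
    have hS4 := (blockProd_mod_four_of_sum p hp hpodd S).1 hS
    have hd8 : (2 * ∏ j ∈ S, p j) % 8 = 6 := by omega
    refine hgen _ hdS hd8 ?_
    by_cases hSu : S = univ
    · left; subst hSu; exact hprod
    · right
      have hquot : n / (2 * ∏ j ∈ S, p j) = ∏ j ∈ Sᶜ, p j := div_twice_blockProd p hp hprod.symm S
      rcases cofactor_mod_eight_of_three p hp hpodd h3 S hS4 with hc1 | hc5
      · refine ⟨by rw [hquot]; exact hc1, ?_⟩
        rw [hquot, ← prod_blockPrimes]
        rw [card_selmerGroup_two_eq_four_iff_det_monskyMatrixOdd (blockPrimes p Sᶜ) (blockPrimes_prime p hp Sᶜ) (blockPrimes_odd p hpodd Sᶜ)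
          (blockPrimes_injective p hinj Sᶜ)]
        exact hcw
      · exfalso
        rw [coblockWeight_eq_zero_of_cofactor_five p hp hpodd hinj S hc5] at hcw
        exact zero_ne_one hcw
  exact rankOne_sha_bsdp_two_of_card_selmer_eight_six_genus p hp hpodd hinj D hprod.symm h3 hrec h35 hLs h318 z Φ ΓH ΓH' σ θ c hc
    (fun d hd => ⟨(hall d hd).1, (hall d hd).2.2.1⟩) (fun d hd h6d => (hall d hd).2.1 h6d)
    (fun d hd h6d => (hall d hd).2.2.2.2.2.2 h6d) h11 hgenus hsel

/-! ## §2 Isogeny saturation (conjuncts 1–3 of 𝔅_ram) -/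

/-- **`BSD(W, 2)` for every globally minimal `W/ℚ` isogenous to such an `E_n`, `n ≡ 6 (mod 8)`** (display shape), granted GZK
(`rank_eq_analyticRank_of_analyticRank_le_one`), `hasEntireLFunction_rat` and Cassels' invariance `bsdRHS_eq_of_isIsogenous` (conjuncts 1–3 of the
route's bundle): `r_an(E_n) = 1`, `BSD(E_n, 2)` by §1, transport by `Wuthrich2014.bsdp_of_isIsogenous`.
[cite: MilneADT2006, Thm. I.7.3] [cite: TianYuanZhang2017, Thm. 1.1 and §3] [cite: Miller2011LMS, Def. 1.1] -/
theorem bsdp_two_of_isIsogenous_selmerEight_six_of_displays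
    (hGZK : rank_eq_analyticRank_of_analyticRank_le_one) (hL : hasEntireLFunction_rat) (hCassels : bsdRHS_eq_of_isIsogenous)
    {W : WeierstrassCurve ℚ} [W.IsElliptic] [W.IsGloballyMinimal]
    {n : ℕ} (hsq : Squarefree n) (h6 : n % 8 = 6)
    (D : GenusPointData n) (hPr : D.Printed)
    (hCM : ∃ (z : ℕ → APoint D.H) (Φ : ℕ → Finset (D.H ≃ₐ[ℚ] D.H)) (ΓH ΓH' : ℕ → Subgroup (D.H ≃ₐ[ℚ] D.H))
      (σ θ : ℕ → (D.H ≃ₐ[ℚ] D.H)) (c : D.H ≃ₐ[ℚ] D.H)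
      (ρ₂ : (d : ℕ) → (D.galK d →* RingClassGroup (GenusField d) 2))
      (ρ₄ : (d : ℕ) → (D.galK d →* RingClassGroup (GenusField d) 4)),
      D.ConjSpec c ∧
      ∀ d ∈ n.divisors,
        ((d % 8 = 5 ∨ d % 8 = 6) → D.CMBlockSpec d (z d) (Φ d) (ΓH d) (ΓH' d) (σ d) c) ∧
        (d % 8 = 6 → D.ThetaBlockSpec d (z d) (ΓH d) (ΓH' d) (σ d) (θ d)) ∧
        (d % 8 = 7 → D.SevenBlockSpec d) ∧
        (d % 8 = 5 → D.RingClassTwoBlockSpec d (ΓH d) (ΓH' d) (ρ₂ d)) ∧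
        (d % 8 = 6 → D.RingClassFourBlockSpec d (ΓH d) (ΓH' d) (ρ₄ d)) ∧
        (d % 8 = 5 → ∀ q : ℕ, q.Prime → q ∣ d → ∃ φ : D.H ≃ₐ[ℚ] D.H,
          φ (D.sqrtNeg d) = D.sqrtNeg d ∧ φ * φ ∈ ΓH' d ∧ φ D.im = (jacobiSym (-1) q) • D.im ∧
            ∀ r : ℕ, r.Prime → r ∣ n → r ≠ q → φ (D.sqrtNeg r) = (jacobiSym (-(r : ℤ)) q) • D.sqrtNeg r) ∧
        (d % 8 = 6 → ∀ q : ℕ, q.Prime → q ∣ d → q ≠ 2 → ∃ φ : D.H ≃ₐ[ℚ] D.H,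
          φ (D.sqrtNeg d) = D.sqrtNeg d ∧ φ * φ ∈ ΓH' d ∧ φ D.im = (jacobiSym (-1) q) • D.im ∧
            ∀ r : ℕ, r.Prime → r ∣ n → r ≠ q → φ (D.sqrtNeg r) = (jacobiSym (-(r : ℤ)) q) • D.sqrtNeg r))
    (h11 : thm11_parity_of_scriptL)
    (hgen : ∀ d ∈ n.divisors, d % 8 = 6 → (d = n ∨ ((n / d) % 8 = 1 ∧ Nat.card ((congruentNumberCurve (n / d)).selmerGroup 2) = 4)) →
      Odd (genusClassNumber (GenusField d)))
    (hsel : haveI := isElliptic_congruentNumberCurve hsq.ne_zero; Nat.card ((congruentNumberCurve n).selmerGroup 2) = 8)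
    (hiso : IsIsogenous W (congruentNumberCurve n)) : BSDp W 2 := by
  haveI := isElliptic_congruentNumberCurve hsq.ne_zero
  haveI := isGloballyMinimal_congruentNumberCurve hsq
  obtain ⟨hr1, -, -, h₀⟩ := rankOne_sha_bsdp_two_of_selmerEight_six_of_displays hsq h6 D hPr hCM h11 hgen hsel
  exact Wuthrich2014.bsdp_of_isIsogenous hCassels hiso (hGZK (congruentNumberCurve n) hr1.le).2
    ((congruentNumberCurve n).leadingLCoeff_ne_zero_holds (hL (congruentNumberCurve n))) h₀

end Summit.BirchSwinnertonDyer.PrintCf2.MoverAssembly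

end
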